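import Summits.CriticalPhenomena.PercolationContinuityZ3.Theorems.PercNearOneGluingNoHeavyConstsMDLXJoint
import Literature.Probability.Percolation.TwoSetConditionalAssociation
import Literature.Probability.Percolation.TripodExchange
import Literature.Probability.Percolation.KozmaNitzanClusterPropertyReal
import HarnessLib

/-!
# MDL(X)′ when the avoided vertex hangs off the marker `y`: the tilt-stability of MDL(∅) (THEOREM)
# (PAPER-2 track (ii): constants of the CSH family; seat `prim-consts-2`, gen 10)

builds on p205010 (kernel theorem, internal audit signed; external expert review pending).  Support file
(`--supports stmt-CriticalPhenomena-4575`); rows A6/A11 of `run/shared/lean/prim/consts/CONSTANTS.md`; memo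
`run/shared/lean/prim/consts/FROM-prim-consts-2-g10-VERTEX-INDUCTION.md` §5.  No definitions, no sorries; standard axioms.

THE CLASS.  In `Consts.MDLXJoint` (MDL(X)′, p' admissible) take the avoided set `X = {x₀}` with `x₀` attached ONLY to the marker `y`,
by a pair of weight `q ∈ [0,1)`.  Then `D = {s ↮ x₀} = {x₀y closed} ∪ {x₀y open, s ↮ y}`, `𝒜 ∩ D = {x₀y closed} ∩ {y ↮ s}`,
`p' = P_{G'}(y ↔ z | y ↮ s)` (`G' = G − x₀`), and with `t = q/(1−q)` every mass of the inequality is `(1−q)·(μ'(E) + t·μ'(E ∩ {s ↮ y}))`: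
under `ν = μ( · | s ↮ x₀)` the cluster of `s` has the law of `μ'` TILTED by the decreasing factor `1 + t·1{y ∉ C_s}`.  Dividing by
`(1−q)³`, MDL(X)′ for this class and every `q` is the statement proved here on `G'` alone:

* `Consts.mdl_nil_tilt_notReach` — **THEOREM.** For every finite weighted graph, `s ≠ y`, `z`, every monotone `F` of the open edge
  cluster of `s` and every `t ≥ 0`, with `N = {s ↮ y}`, `Y = {s ↔ y}`, `Z = {s ↔ z}`, `W = {y ↔ z}`, `I_E = ∫_E F(C_s) dμ`:
  `μ(N ∩ W)·[(1 + t μ(N)) I_Y − (I + t I_N) μ(Y)] ≤ μ(N)·[(1 + t μ(N))(I_Z + t I_{Z∩N}) − (I + t I_N)(μ(Z) + t μ(Z ∩ N))]`,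
  i.e. `Cov_{ν_t}(F, 1_Z) ≥ P(y ↔ z | y ↮ s) · Cov_{ν_t}(F, 1_Y)` for the tilted law `ν_t ∝ (1 + t·1_N)·μ`.  At `t = 0` this is MDL(∅).

PROOF (mixture decomposition; the identity is `ring`-checked in the file).  `ν_t` is the mixture `α μ + β μ( · | N)`, so
`m²·[RHS − LHS] = (1 + tμ(N))·M₀ + t(1 + tμ(N))·B₂ + t·H₃·H₄` with
`M₀ = μ(N)(I_Z − I μ(Z)) − μ(N∩W)(I_Y − I μ(Y)) ≥ 0` — MDL(∅) (`CovTau.markerDominanceAvoid` at `X = ∅`);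
`B₂ = μ(N) I_{Z∩N} − I_N μ(Z∩N) ≥ 0` — van den Berg–Häggström–Kahn Thm 1.3 (`F`, `1{s↔z}` positively correlated given `s ↮ y`);
`H₃ = μ(N) I − I_N = I_Y − I μ(Y) ≥ 0` — Thm 1.3 with no conditioning (Harris for `F` and `1{s ↔ y}`);
`H₄ = μ(Z ∩ Y) − μ(Y)μ(Z) − μ(Y)μ(N ∩ W) ≥ 0` — MDL(∅) at `F = 1{s ↔ y}` (the marker inequality
`P(s↔z | s↔y) ≥ P(s↔z | s↮y) + P(y↔z | s↮y)`).
This is the first class with ALL monotone `F` in which the avoided set is entangled with a marker (proved classes so far: `X = ∅`,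
single pair, marker lattice — all `X`; this file — all `F`).  Numerics (exact, this seat): the middle Bernstein coefficient of the class
is not termwise signed (its two natural parts fail 123/200 and 69/200 at n = 5) but the sum never fails (0/300), as the identity explains.
[cite: VandenbergHaggstromKahn2005, Thm. 1.3 (p. 6) with Remark 1 after Thm. 1.2 (p. 5); §2.1 (pp. 9–13)]
-/

noncomputable section

namespace Summit.CriticalPhenomena.PercolationContinuityZ3.Theorems

open MeasureTheory Set Literature.Probability.LatticeModels Literature.Probability.Percolation
open scoped Classical

namespace Consts

variable {V : Type*} [Fintype V]

/-- **MDL(∅) is stable under tilting by `1 + t·1{s ↮ y}` (= MDL(X)′ for an avoided vertex hanging off the marker `y`).**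
For `s ≠ y`, `z`, monotone `F`, `t ≥ 0`, with `N = {s ↮ y}`, `Y = {s ↔ y}`, `Z = {s ↔ z}`, `W = {y ↔ z}` and `I_E = ∫_E F(C_s) dμ`:
`μ(N ∩ W)·[(1 + t μ(N)) I_Y − (I + t I_N) μ(Y)] ≤ μ(N)·[(1 + t μ(N))(I_Z + t I_{Z∩N}) − (I + t I_N)(μ(Z) + t μ(Z∩N))]`.
Proof: `RHS − LHS = (1 + tμ(N)) M₀ + t(1 + tμ(N)) B₂ + t H₃ H₄` with `M₀` = MDL(∅), `B₂` = vdBHK Thm 1.3 given `s ↮ y`, `H₃` = Harris,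
`H₄` = MDL(∅) at `1{s↔y}`, all nonnegative.
[cite: VandenbergHaggstromKahn2005, Thm. 1.3 (p. 6) with Remark 1 after Thm. 1.2 (p. 5); §2.1 (pp. 9–13)] -/
theorem mdl_nil_tilt_notReach (w : Sym2 V → unitInterval) (s y z : V) (hsy : s ≠ y)
    (F : Set (Sym2 V) → ℝ) (hF : Monotone F) (t : ℝ) (ht : 0 ≤ t) :
    (prodBernoulli w).real ((openConn s y : Set (BondConfig V))ᶜ ∩ openConn y z) *
        ((1 + t * (prodBernoulli w).real (openConn s y : Set (BondConfig V))ᶜ) *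
            (∫ ω in openConn s y, F (openEdgeCluster ω s) ∂(prodBernoulli w)) -
          ((∫ ω, F (openEdgeCluster ω s) ∂(prodBernoulli w)) +
              t * ∫ ω in (openConn s y : Set (BondConfig V))ᶜ, F (openEdgeCluster ω s) ∂(prodBernoulli w)) *
            (prodBernoulli w).real (openConn s y)) ≤
      (prodBernoulli w).real (openConn s y : Set (BondConfig V))ᶜ *
        ((1 + t * (prodBernoulli w).real (openConn s y : Set (BondConfig V))ᶜ) *
            ((∫ ω in openConn s z, F (openEdgeCluster ω s) ∂(prodBernoulli w)) +
              t * ∫ ω in openConn s z ∩ (openConn s y : Set (BondConfig V))ᶜ, F (openEdgeCluster ω s) ∂(prodBernoulli w)) -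
          ((∫ ω, F (openEdgeCluster ω s) ∂(prodBernoulli w)) +
              t * ∫ ω in (openConn s y : Set (BondConfig V))ᶜ, F (openEdgeCluster ω s) ∂(prodBernoulli w)) *
            ((prodBernoulli w).real (openConn s z) +
              t * (prodBernoulli w).real (openConn s z ∩ (openConn s y : Set (BondConfig V))ᶜ))) := by
  classical
  set μ := prodBernoulli w with hμ
  set Y : Set (BondConfig V) := openConn s y with hY
  set Z : Set (BondConfig V) := openConn s z with hZ
  set W : Set (BondConfig V) := openConn y z with hW
  set f : BondConfig V → ℝ := fun ω => F (openEdgeCluster ω s) with hf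
  have hmeas : ∀ T : Set (BondConfig V), MeasurableSet T := fun _ => MeasurableSet.of_discrete
  have hint : ∀ T : Set (BondConfig V), Integrable f (μ.restrict T) := fun _ => Integrable.of_finite
  -- (0) bookkeeping: `μ(N) = 1 − μ(Y)`, `I = I_Y + I_N`, `μ(Z) = μ(Z ∩ Y) + μ(Z ∩ N)`, `I_Z = I_{Z∩Y} + I_{Z∩N}`
  have hN : μ.real Yᶜ = 1 - μ.real Y := by
    have h := measureReal_add_measureReal_compl (μ := μ) (hmeas Y)
    rw [probReal_univ] at h
    linarith
  have hI : ∫ ω, f ω ∂μ = (∫ ω in Y, f ω ∂μ) + ∫ ω in Yᶜ, f ω ∂μ :=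
    (integral_add_compl (hmeas Y) Integrable.of_finite).symm
  have hdiff : Z \ Y = Z ∩ Yᶜ := by
    ext ω; simp only [mem_sdiff, mem_inter_iff, mem_compl_iff]
  have hZsplit : μ.real Z = μ.real (Z ∩ Y) + μ.real (Z ∩ Yᶜ) := by
    have h := measureReal_inter_add_sdiff (μ := μ) (s := Z) (hmeas Y)
    rw [hdiff] at h
    exact h.symm
  have hIZsplit : ∫ ω in Z, f ω ∂μ = (∫ ω in Z ∩ Y, f ω ∂μ) + ∫ ω in Z ∩ Yᶜ, f ω ∂μ := by
    have h := integral_inter_add_sdiff (μ := μ) (s := Z) (hmeas Y) (hint Z)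
    rw [hdiff] at h
    exact h.symm
  -- the sets of the tree statements at `X = ∅`
  have hDuniv : {ω : BondConfig V | ∀ x ∈ (∅ : Set V), ¬ (openGraph ω).Reachable s x} = Set.univ := by
    ext ω; simp
  have hAN : {ω : BondConfig V | ∀ x ∈ insert s (∅ : Set V), ¬ (openGraph ω).Reachable y x} = Yᶜ := by
    ext ω
    simp only [mem_insert_iff, mem_empty_iff_false, or_false, forall_eq, mem_setOf_eq, mem_compl_iff, hY, openConn]
    exact ⟨fun h hr => h hr.symm, fun h hr => h hr.symm⟩
  have hSN : {ω : BondConfig V | ∀ a ∈ ({s} : Set V), ∀ b ∈ ({y} : Set V), ¬ (openGraph ω).Reachable a b} = Yᶜ := by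
    ext ω
    simp only [mem_singleton_iff, forall_eq, mem_setOf_eq, mem_compl_iff, hY, openConn]
  have hS0 : {ω : BondConfig V | ∀ a ∈ ({s} : Set V), ∀ b ∈ (∅ : Set V), ¬ (openGraph ω).Reachable a b} = Set.univ := by
    ext ω; simp
  have hU : ∀ ω : BondConfig V, (⋃ a ∈ ({s} : Set V), openEdgeCluster ω a) = openEdgeCluster ω s := by
    intro ω; ext e; simp
  -- (1) M₀ ≥ 0 : MDL(∅)
  have hM0 : μ.real (Yᶜ ∩ W) * ((∫ ω in Y, f ω ∂μ) - (∫ ω, f ω ∂μ) * μ.real Y) ≤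
      μ.real Yᶜ * ((∫ ω in Z, f ω ∂μ) - (∫ ω, f ω ∂μ) * μ.real Z) := by
    have key := CovTau.markerDominanceAvoid w s y z (∅ : Set V) hsy F hF
    simp only [hDuniv, hAN, Set.univ_inter, probReal_univ, Measure.restrict_univ, one_mul] at key
    exact key
  -- (4) H₄ ≥ 0 : MDL(∅) at `F = 1{s ↔ y}`
  have hH4 : 0 ≤ μ.real (Z ∩ Y) - μ.real Y * μ.real Z - μ.real Y * μ.real (Yᶜ ∩ W) := by
    have key := CovTau.markerDominanceAvoid w s y z (∅ : Set V) hsy (connIndicatorFn s y) (monotone_connIndicatorFn s y)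
    simp only [hDuniv, hAN, Set.univ_inter, probReal_univ, Measure.restrict_univ, one_mul] at key
    simp_rw [connIndicatorFn_openEdgeCluster] at key
    rw [TripodExchange.setIntegral_indicator_one_eq, TripodExchange.setIntegral_indicator_one_eq,
      integral_indicator_one (hmeas _), Set.inter_self] at key
    rw [← hY, ← hZ, ← hW, ← hμ, hN] at key
    -- key : μ(Yᶜ ∩ W) * (μ Y - μ Y * μ Y) ≤ (1 - μ Y) * (μ (Z ∩ Y) - μ Y * μ Z)
    have hYnn : 0 ≤ μ.real Y := measureReal_nonneg
    have hY1 : μ.real Y ≤ 1 := measureReal_le_one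
    have hNW : 0 ≤ μ.real (Yᶜ ∩ W) := measureReal_nonneg
    by_cases hY0 : μ.real Y = 1
    · -- then `μ N = 0`, so `μ(N ∩ W) = 0` and `μ(Z ∩ N) = 0`
      have hN0 : μ.real Yᶜ = 0 := by rw [hN, hY0, sub_self]
      have hNW0 : μ.real (Yᶜ ∩ W) = 0 :=
        le_antisymm ((measureReal_mono Set.inter_subset_left).trans hN0.le) measureReal_nonneg
      have hZN0 : μ.real (Z ∩ Yᶜ) = 0 :=
        le_antisymm ((measureReal_mono Set.inter_subset_right).trans hN0.le) measureReal_nonneg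
      rw [hNW0, hY0, hZsplit, hZN0]
      linarith
    · have hpos : 0 < 1 - μ.real Y := by
        rcases lt_or_eq_of_le hY1 with h | h
        · linarith
        · exact absurd h hY0
      have h' : 0 ≤ (1 - μ.real Y) * (μ.real (Z ∩ Y) - μ.real Y * μ.real Z - μ.real Y * μ.real (Yᶜ ∩ W)) := by
        nlinarith [key]
      refine le_of_not_gt (fun hlt => ?_)
      have := mul_neg_of_pos_of_neg hpos hlt
      linarith
  -- (3) H₃ ≥ 0 : Harris (Thm 1.3 with nothing avoided) for `F` and `1{s ↔ y}`
  have hH3 : 0 ≤ (∫ ω in Y, f ω ∂μ) - (∫ ω, f ω ∂μ) * μ.real Y := by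
    have key := BHK2006_setClusterConditionalPositiveAssociation w ({s} : Set V) (∅ : Set V) F (connIndicatorFn s y)
      hF (monotone_connIndicatorFn s y)
    simp only [hS0, Measure.restrict_univ, probReal_univ, one_mul, hU] at key
    simp_rw [connIndicatorFn_openEdgeCluster] at key
    rw [integral_indicator_one (hmeas _), ← hf] at key
    have h2 : ∫ ω, f ω * (openConn s y : Set (BondConfig V)).indicator 1 ω ∂μ = ∫ ω in Y, f ω ∂μ := by
      have := KNPreFKG.setIntegral_mul_indicator_one μ Set.univ Y f
      rwa [Measure.restrict_univ, Set.univ_inter] at this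
    rw [h2] at key
    linarith
  -- (2) B₂ ≥ 0 : Thm 1.3 given `s ↮ y` for `F` and `1{s ↔ z}`
  have hB2 : 0 ≤ μ.real Yᶜ * (∫ ω in Z ∩ Yᶜ, f ω ∂μ) - (∫ ω in Yᶜ, f ω ∂μ) * μ.real (Z ∩ Yᶜ) := by
    have key := BHK2006_setClusterConditionalPositiveAssociation w ({s} : Set V) ({y} : Set V) F (connIndicatorFn s z)
      hF (monotone_connIndicatorFn s z)
    simp only [hSN, hU] at key
    simp_rw [connIndicatorFn_openEdgeCluster] at key
    rw [TripodExchange.setIntegral_indicator_one_eq, ← hf, KNPreFKG.setIntegral_mul_indicator_one μ Yᶜ Z f] at key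
    rw [Set.inter_comm] at key
    linarith
  -- nonnegativity of the weights of the certificate, in the atoms `I_Y, I_N, I_{Z∩Y}, I_{Z∩N}, μY, μ(Z∩Y), μ(Z∩N), μ(N∩W)`
  rw [hI, hZsplit, hIZsplit, hN] at hM0
  rw [hI] at hH3
  rw [hZsplit] at hH4
  rw [hN] at hB2
  have hYle : μ.real Y ≤ 1 := measureReal_le_one
  have h1tn : 0 ≤ 1 + t * (1 - μ.real Y) := by nlinarith [hYle, ht]
  have c1 := mul_nonneg h1tn (sub_nonneg.2 hM0)
  have c2 := mul_nonneg (mul_nonneg ht h1tn) hB2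
  have c3 := mul_nonneg ht (mul_nonneg hH3 hH4)
  -- the identity `RHS − LHS = (1 + tμN) M₀ + t (1 + tμN) B₂ + t H₃ H₄`
  rw [hI, hZsplit, hIZsplit, hN]
  nlinarith [c1, c2, c3]

end Consts

end Summit.CriticalPhenomena.PercolationContinuityZ3.Theorems

end
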